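import Literature.Probability.LatticeModels.SpinorCornerFlux
import Literature.Probability.LatticeModels.FKObservableL2Bound
import HarnessLib

/-!
# Remark 3.7 for spinor sections: the increments of `H` across a medial vertex

Topic `Literature/Probability/LatticeModels`; a complement to `SHolomorphicPrimitive.lean`
(`cornerFlux_sub_cornerFlux_eq_im`: white increment `-Im(i^k F(e)²)/√2`) and
`FKObservableL2Bound.lean` (`cornerFlux_add_three_sub_cornerFlux_eq_re`: black increment
`Re(i^k F(e)²)/√2`), which assume s-holomorphicity at one corner. For a spinor SECTION
(Chelkak–Hongler–Izyurov 2015, Prop. 2.4: the spin fermion, s-holomorphic off a seam and with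
opposite projections across it) the same identities hold with `RelAt` ("s-holomorphic or opposite")
in place of `IsSHolAt`: both sides are blind to the sign of `F` on one bond (`cornerFlux` is a
squared length, the right-hand sides are quadratic in `F(e)`), and negating `F` on the bond `e`
turns an opposite corner into an s-holomorphic one (`SpinorCornerFlux.lean`).

* `cornerFlux_sub_cornerFlux_eq_im_of_relAt`, `cornerFlux_add_three_sub_cornerFlux_eq_re_of_relAt`;
* hence `norm_sq_le_of_increments` of `FKObservableL2Bound.lean` applies to spinor sections:
  `‖F(e)‖² ≤ √2 (|white increment| + |black increment|)` (`norm_sq_le_increments_of_relAt`).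

Everything is proved; no named fact.

## References

* S. Smirnov, Ann. of Math. 172 (2010), Remark 3.7 [Smirnov2010].
* D. Chelkak, C. Hongler, K. Izyurov, Ann. of Math. 181 (2015), Prop. 2.4, Prop. 3.6
  [ChelkakHonglerIzyurovAnnals2015].
-/

noncomputable section

namespace Literature.Probability.LatticeModels

open Complex

/-- The two bonds of a corner are distinct medial vertices. [folklore] -/
theorem cSrc_ne_cSrc_add (u : Site 2) (k j : Fin 4) (hj : j ≠ 0) : cSrc (u, k + j) ≠ cSrc (u, k) := by
  simp only [cSrc]
  intro h
  rcases Sym2.eq_iff.1 h with ⟨-, h2⟩ | ⟨h1, -⟩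
  · have : cornerUnit (k + j) = cornerUnit k := add_left_cancel h2
    have := cornerUnit_injective this
    exact hj (by simpa using this)
  · exact cornerUnit_ne_zero k (by simpa using h1.symm)

/-- Negating a bond function on one bond. [folklore] -/
def negateAt (F : MedialVertex → ℂ) (e : MedialVertex) : MedialVertex → ℂ := fun e' => if e' = e then -F e' else F e'

/-- `negateAt` at the bond. [folklore] -/
theorem negateAt_self (F : MedialVertex → ℂ) (e : MedialVertex) : negateAt F e e = -F e := by simp [negateAt]

/-- `negateAt` elsewhere. [folklore] -/
theorem negateAt_of_ne (F : MedialVertex → ℂ) {e e' : MedialVertex} (h : e' ≠ e) : negateAt F e e' = F e' := by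
  simp [negateAt, h]

/-- Fluxes do not see `negateAt`. [folklore] -/
theorem cornerFlux_negateAt (F : MedialVertex → ℂ) (e : MedialVertex) (q : Site 2 × Fin 4) :
    cornerFlux (negateAt F e) q = cornerFlux F q := by
  refine cornerFlux_eq_of_eq_neg ?_
  by_cases h : cSrc q = e
  · right; rw [h, negateAt_self]
  · left; rw [negateAt_of_ne F h]

/-- An opposite corner becomes s-holomorphic after negating the function on its target bond
(when the two bonds differ). [folklore] -/
theorem isSHolAt_negateAt_of_eq_neg {F : MedialVertex → ℂ} {q : Site 2 × Fin 4} (hne : cSrc q ≠ cTgt q)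
    (h : projLine (cornerLine q.1 (cFace q)) (F (cSrc q)) = -projLine (cornerLine q.1 (cFace q)) (F (cTgt q))) :
    IsSHolAt (negateAt F (cTgt q)) q := by
  unfold IsSHolAt
  rw [negateAt_of_ne F hne, negateAt_self, h, projLine_eq, projLine_eq, ← neg_smul]
  congr 1
  rw [neg_mul, Complex.neg_re, neg_div]

/-- **White increment across `e_k` for a spinor section** (Remark 3.7):
`Φ(u,k) - Φ(u+e_k, k+1) = -Im(i^k F(e_k)²)/√2` as soon as the corner `(u + e_k, k+1)` is related. [cite: Smirnov2010, Remark 3.7; ChelkakHonglerIzyurovAnnals2015, Prop. 3.6] -/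
theorem cornerFlux_sub_cornerFlux_eq_im_of_relAt (F : MedialVertex → ℂ) (u : Site 2) (k : Fin 4)
    (h₂ : RelAt F (u + cornerUnit k, k + 1)) :
    cornerFlux F (u, k) - cornerFlux F (u + cornerUnit k, k + 1) =
      -(I ^ (k : ℕ) * F (cSrc (u, k)) ^ 2).im / Real.sqrt 2 := by
  rcases h₂ with h₂ | h₂
  · exact cornerFlux_sub_cornerFlux_eq_im F u k h₂
  · have htgt : cTgt (u + cornerUnit k, k + 1) = cSrc (u, k) := cTgt_add_cornerUnit_succ u k
    have hne : cSrc (u + cornerUnit k, k + 1) ≠ cTgt (u + cornerUnit k, k + 1) := by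
      rw [htgt]
      simp only [cSrc]
      intro h
      rcases Sym2.eq_iff.1 h with ⟨h1, -⟩ | ⟨-, h2⟩
      · exact cornerUnit_ne_zero k (by simpa using h1)
      · have hsum : cornerUnit k + cornerUnit (k + 1) = 0 := by
          have := h2; rw [add_assoc] at this; simpa using this
        have e2 := cornerUnit_add_two (k + 1)
        rw [show k + 1 + 2 = k + 3 from by fin_cases k <;> rfl] at e2
        have h3 : cornerUnit k = cornerUnit (k + 3) := by rw [e2]; linear_combination hsum
        have h4 := cornerUnit_injective h3
        revert h4; fin_cases k <;> decide
    have hS := isSHolAt_negateAt_of_eq_neg hne h₂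
    rw [htgt] at hS
    have key := cornerFlux_sub_cornerFlux_eq_im (negateAt F (cSrc (u, k))) u k hS
    rwa [cornerFlux_negateAt, cornerFlux_negateAt, negateAt_self, neg_sq] at key

/-- **Black increment across `e_k` for a spinor section** (Remark 3.7):
`Φ(u,k+3) - Φ(u,k) = Re(i^k F(e_k)²)/√2` as soon as the corner `(u, k+3)` is related. [cite: Smirnov2010, Remark 3.7; ChelkakHonglerIzyurovAnnals2015, Prop. 3.6] -/
theorem cornerFlux_add_three_sub_cornerFlux_eq_re_of_relAt (F : MedialVertex → ℂ) (u : Site 2) (k : Fin 4)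
    (h₃ : RelAt F (u, k + 3)) :
    cornerFlux F (u, k + 3) - cornerFlux F (u, k) = (I ^ (k : ℕ) * F (cSrc (u, k)) ^ 2).re / Real.sqrt 2 := by
  rcases h₃ with h₃ | h₃
  · exact cornerFlux_add_three_sub_cornerFlux_eq_re F u k h₃
  · have htgt : cTgt (u, k + 3) = cSrc (u, k) := cTgt_add_three u k
    have hne : cSrc (u, k + 3) ≠ cTgt (u, k + 3) := by
      rw [htgt]; exact cSrc_ne_cSrc_add u k 3 (by decide)
    have hS := isSHolAt_negateAt_of_eq_neg hne h₃
    rw [htgt] at hS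
    have key := cornerFlux_add_three_sub_cornerFlux_eq_re (negateAt F (cSrc (u, k))) u k hS
    rwa [cornerFlux_negateAt, cornerFlux_negateAt, negateAt_self, neg_sq] at key

/-- **`‖F(e)‖² ≤ √2 (|white| + |black|)` for spinor sections.** [cite: Smirnov2010, Remark 3.7] -/
theorem norm_sq_le_increments_of_relAt (F : MedialVertex → ℂ) (u : Site 2) (k : Fin 4)
    (h₂ : RelAt F (u + cornerUnit k, k + 1)) (h₃ : RelAt F (u, k + 3)) :
    ‖F (cSrc (u, k))‖ ^ 2 ≤ Real.sqrt 2 *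
      (|cornerFlux F (u, k) - cornerFlux F (u + cornerUnit k, k + 1)| + |cornerFlux F (u, k + 3) - cornerFlux F (u, k)|) :=
  norm_sq_le_of_increments F u k (cornerFlux_sub_cornerFlux_eq_im_of_relAt F u k h₂)
    (cornerFlux_add_three_sub_cornerFlux_eq_re_of_relAt F u k h₃)

end Literature.Probability.LatticeModels
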